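import Literature.MathematicalPhysics.QuantumManyBody.PeriodicGroundStateFeynmanKacProofsEigen
import Literature.MathematicalPhysics.QuantumManyBody.GroundStateFeynmanKacProofs
import HarnessLib

/-!
# Proof of `PeriodicGroundStateFeynmanKac`, II: the witness `Ψ₀ = μ₀⁻¹ e^{-H}|e ∘ cellProj L|` and the Rayleigh bound

Topic `Literature/MathematicalPhysics/QuantumManyBody`; theorems only (no definition, no named
fact). Second of three files discharging the named fact
`Literature.MathematicalPhysics.QuantumManyBody.BoseGas.PeriodicGroundStateFeynmanKac` of
`PeriodicHeatFlowSpectral.lean` (torus twin of Part IV of `GroundStateFeynmanKacProofs.lean`).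
With the Perron–Frobenius unit eigenvector `e ≥ 0` of `T_1 = e^{-H_N^per} = pfkL2 v L 1` on
`L²([0,L)^{3N})` for `μ₀ = ‖T_1‖` (`pfkL2_perronFrobenius`; `v^per ≤ C`, `L > 0`) and its periodic
representative `|e ∘ cellProj L|` (`PeriodicGroundStateFeynmanKacProofsEigen.lean`), the WITNESS is
the function `Ψ₀ = μ₀⁻¹ · e^{-H}|e ∘ cellProj L| = μ₀⁻¹ pfkReal v L 1 |e ∘ cellProj L|`, defined at
every point of `(ℝ³)^N` through the path integral (hypothesis `hΨ` below; Chung–Zhao's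
`φ₁ = e^{-λ₁} T_1 φ₁`, §8.3 (29)). Proved here:

* `Ψ₀` is nonnegative, `Lℤ³`-periodic, measurable, **continuous** (strong Feller property
  `continuous_pfkReal`, Chung–Zhao Prop 3.12 — no boundary on the torus), equal to `e` a.e. on the
  cell and to `|e ∘ cellProj L|` a.e. on `(ℝ³)^N`;
* `pfkReal_periodicWitness` — the **pointwise eigen-relation `e^{-TH}Ψ₀ = μ₀ᵀ Ψ₀`** for every
  `T > 0` at EVERY point (semigroup law and insensitivity of `e^{-H}` to null modifications);
* `periodicWitness_pos` — **`Ψ₀ > 0` everywhere** (positivity improving at every point,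
  `pfkReal_pos_of_nonneg`; Reed–Simon IV Thm XIII.44);
* `setIntegral_cellN_mul_pfkReal_le_rpow` — the **Rayleigh bound**
  `⟨f, e^{-tH}f⟩_cell ≤ μ₀ᵗ ‖f‖²_cell` for periodic `f ∈ L²(cell)` (the abstract
  `inner_semigroup_le_rpow_mul` of `GroundStateFeynmanKacProofs.lean`; Chung–Zhao Thm 3.27,
  `‖T_t‖₂ = e^{λ₁t}`).

## References

* K. L. Chung, Z. Zhao, *From Brownian Motion to Schrödinger's Equation*, Grundlehren 312,
  Springer (1995), Prop 3.12, Thm 3.27, §8.3 (29). [ChungZhao1995]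
* M. Reed, B. Simon, *Methods of Modern Mathematical Physics IV: Analysis of Operators*,
  Academic Press (1978), Thm XIII.44. [ReedSimonIV1978]
-/

noncomputable section

namespace Literature.MathematicalPhysics.QuantumManyBody.BoseGas

open MeasureTheory ProbabilityTheory Filter Set
open scoped ENNReal NNReal Topology InnerProductSpace
open Literature.Probability.Process

variable {N : ℕ}

/-! ### The witness `Ψ₀ = ‖e^{-H}‖⁻¹ e^{-H} |e ∘ cellProj L|` -/

section Witness

variable {v : ℝ → ℝ≥0∞} {L : ℝ} {C : ℝ≥0} {e : Lp ℝ 2 (volume.restrict (cellN N L))}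
  {Ψ₀ : Config N → ℝ}

/-- `Ψ₀ ≥ 0`. [folklore] -/
theorem periodicWitness_nonneg
    (hΨ : ∀ X, Ψ₀ X = ‖pfkL2 (N := N) v L 1‖⁻¹ *
      pfkReal v L 1 (fun Y => |(e : Config N → ℝ) (cellProj L Y)|) X)
    (X : Config N) : 0 ≤ Ψ₀ X := by
  rw [hΨ]
  exact mul_nonneg (inv_nonneg.2 (norm_nonneg _)) (pfkReal_nonneg v L 1 (fun Y => abs_nonneg _) X)

/-- `Ψ₀` is `Lℤ³`-periodic in every particle. [folklore] -/
theorem periodicWitness_periodic (hL : L ≠ 0)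
    (hΨ : ∀ X, Ψ₀ X = ‖pfkL2 (N := N) v L 1‖⁻¹ *
      pfkReal v L 1 (fun Y => |(e : Config N → ℝ) (cellProj L Y)|) X)
    (X : Config N) (i : Fin N) (k : Fin 3) :
    Ψ₀ (X + Pi.single i (EuclideanSpace.single k L)) = Ψ₀ X := by
  rw [hΨ, hΨ, pfkReal_add_single_of_periodic v L 1 (abs_coeFn_cellProj_periodic hL e)]

/-- `Ψ₀` is measurable. [folklore] -/
theorem measurable_periodicWitness (hv : Measurable v)
    (hΨ : ∀ X, Ψ₀ X = ‖pfkL2 (N := N) v L 1‖⁻¹ *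
      pfkReal v L 1 (fun Y => |(e : Config N → ℝ) (cellProj L Y)|) X) :
    Measurable Ψ₀ := by
  rw [show Ψ₀ = fun X => ‖pfkL2 (N := N) v L 1‖⁻¹ *
      pfkReal v L 1 (fun Y => |(e : Config N → ℝ) (cellProj L Y)|) X from funext hΨ]
  exact (measurable_pfkReal hv L 1 (measurable_abs_coeFn_cellProj e)).const_mul _

/-- **`Ψ₀` is continuous** (strong Feller property of `e^{-H}` on periodic `L²(cell)` data,
`continuous_pfkReal`). [cite: ChungZhao1995, Prop 3.12] -/
theorem continuous_periodicWitness (hv : Measurable v) (hL : 0 < L)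
    (hC : ∀ x, periodizedPotential v L x ≤ C)
    (hΨ : ∀ X, Ψ₀ X = ‖pfkL2 (N := N) v L 1‖⁻¹ *
      pfkReal v L 1 (fun Y => |(e : Config N → ℝ) (cellProj L Y)|) X) :
    Continuous Ψ₀ := by
  rw [show Ψ₀ = fun X => ‖pfkL2 (N := N) v L 1‖⁻¹ *
      pfkReal v L 1 (fun Y => |(e : Config N → ℝ) (cellProj L Y)|) X from funext hΨ]
  exact continuous_const.mul (continuous_pfkReal hv hL hC one_pos
    (measurable_abs_coeFn_cellProj e) (abs_coeFn_cellProj_periodic hL.ne' e)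
    (setLIntegral_cellN_abs_coeFn_cellProj_sq_ne_top hL e))

/-- **`Ψ₀ = e` a.e. on the cell** (`e^{-H}|e ∘ cellProj| = ‖e^{-H}‖ e` a.e. on the cell).
[folklore] -/
theorem periodicWitness_ae_eq_cellN (hv : Measurable v) (hL : 0 < L)
    (hC : ∀ x, periodizedPotential v L x ≤ C) (he1 : ‖e‖ = 1) (he0 : 0 ≤ e)
    (hTe : pfkL2 v L 1 e = ‖pfkL2 (N := N) v L 1‖ • e)
    (hsimple : ∀ f, pfkL2 v L 1 f = ‖pfkL2 (N := N) v L 1‖ • f → ∃ c : ℝ, f = c • e)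
    (hΨ : ∀ X, Ψ₀ X = ‖pfkL2 (N := N) v L 1‖⁻¹ *
      pfkReal v L 1 (fun Y => |(e : Config N → ℝ) (cellProj L Y)|) X) :
    Ψ₀ =ᵐ[volume.restrict (cellN N L)] (e : Config N → ℝ) := by
  have hμ₀ : 0 < ‖pfkL2 (N := N) v L 1‖ :=
    norm_pos_iff.2 (pfkL2_perronFrobenius (N := N) hv hL hC one_pos).1
  filter_upwards [pfkReal_abs_coeFn_cellProj_ae_eq_cellN hv hL hC he1 he0 hTe hsimple one_pos]
    with Y hY
  rw [hΨ, hY, Real.rpow_one, ← mul_assoc, inv_mul_cancel₀ hμ₀.ne', one_mul]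

/-- `Ψ₀ = |e ∘ cellProj L|` a.e. on `(ℝ³)^N`. [folklore] -/
theorem periodicWitness_ae_eq (hv : Measurable v) (hL : 0 < L)
    (hC : ∀ x, periodizedPotential v L x ≤ C) (he1 : ‖e‖ = 1) (he0 : 0 ≤ e)
    (hTe : pfkL2 v L 1 e = ‖pfkL2 (N := N) v L 1‖ • e)
    (hsimple : ∀ f, pfkL2 v L 1 f = ‖pfkL2 (N := N) v L 1‖ • f → ∃ c : ℝ, f = c • e)
    (hΨ : ∀ X, Ψ₀ X = ‖pfkL2 (N := N) v L 1‖⁻¹ *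
      pfkReal v L 1 (fun Y => |(e : Config N → ℝ) (cellProj L Y)|) X) :
    Ψ₀ =ᵐ[(volume : Measure (Config N))] fun Y => |(e : Config N → ℝ) (cellProj L Y)| := by
  have hμ₀ : 0 < ‖pfkL2 (N := N) v L 1‖ :=
    norm_pos_iff.2 (pfkL2_perronFrobenius (N := N) hv hL hC one_pos).1
  filter_upwards [pfkReal_abs_coeFn_cellProj_ae_eq hv hL hC he1 he0 hTe hsimple one_pos]
    with Y hY
  rw [hΨ, hY, Real.rpow_one, ← mul_assoc, inv_mul_cancel₀ hμ₀.ne', one_mul]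

/-- **The pointwise eigen-relation `e^{-TH} Ψ₀ = ‖e^{-H}‖ᵀ Ψ₀`** for every `T > 0`, at EVERY
point: `e^{-TH}Ψ₀ = ‖e^{-H}‖⁻¹ e^{-(T+1)H}|e∘cellProj| = ‖e^{-H}‖⁻¹ e^{-H}(‖e^{-H}‖ᵀ |e∘cellProj|)`
(semigroup law twice; `e^{-H}` does not see null modifications). Chung–Zhao (1995), §8.3 (29).
[folklore] -/
theorem pfkReal_periodicWitness (hv : Measurable v) (hL : 0 < L)
    (hC : ∀ x, periodizedPotential v L x ≤ C) (he1 : ‖e‖ = 1) (he0 : 0 ≤ e)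
    (hTe : pfkL2 v L 1 e = ‖pfkL2 (N := N) v L 1‖ • e)
    (hsimple : ∀ f, pfkL2 v L 1 f = ‖pfkL2 (N := N) v L 1‖ • f → ∃ c : ℝ, f = c • e)
    (hΨ : ∀ X, Ψ₀ X = ‖pfkL2 (N := N) v L 1‖⁻¹ *
      pfkReal v L 1 (fun Y => |(e : Config N → ℝ) (cellProj L Y)|) X)
    {T : ℝ} (hT : 0 < T) (X : Config N) :
    pfkReal v L T Ψ₀ X = ‖pfkL2 (N := N) v L 1‖ ^ T * Ψ₀ X := by
  set g : Config N → ℝ := fun Y => |(e : Config N → ℝ) (cellProj L Y)| with hg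
  have hgm : Measurable g := measurable_abs_coeFn_cellProj e
  have hgper := abs_coeFn_cellProj_periodic (N := N) hL.ne' e
  have hg2 := setLIntegral_cellN_abs_coeFn_cellProj_sq_ne_top (N := N) hL e
  have hfun : Ψ₀ = fun X => ‖pfkL2 (N := N) v L 1‖⁻¹ * pfkReal v L 1 g X := funext hΨ
  have h1 : pfkReal v L T Ψ₀ X = ‖pfkL2 (N := N) v L 1‖⁻¹ * pfkReal v L (T + 1) g X := by
    rw [hfun, pfkReal_const_mul, ← pfkReal_add_time hv hL hT one_pos hgm hgper hg2 X]
  have h2 : pfkReal v L (T + 1) g X = ‖pfkL2 (N := N) v L 1‖ ^ T * pfkReal v L 1 g X := by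
    rw [add_comm, pfkReal_add_time hv hL one_pos hT hgm hgper hg2 X,
      pfkReal_congr_ae v L one_pos (pfkReal_abs_coeFn_cellProj_ae_eq hv hL hC he1 he0 hTe hsimple hT) X,
      pfkReal_const_mul]
  rw [h1, h2, hΨ X]
  ring

/-- **`Ψ₀ > 0` EVERYWHERE** (positivity improving of `e^{-H}` at every point,
`pfkReal_pos_of_nonneg`; `|e ∘ cellProj L|` is not a.e. zero on the cell since `‖e‖ = 1`).
[cite: ReedSimonIV1978, Thm XIII.44] -/
theorem periodicWitness_pos (hv : Measurable v) (hL : 0 < L)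
    (hC : ∀ x, periodizedPotential v L x ≤ C) (he1 : ‖e‖ = 1) (he0 : 0 ≤ e)
    (hΨ : ∀ X, Ψ₀ X = ‖pfkL2 (N := N) v L 1‖⁻¹ *
      pfkReal v L 1 (fun Y => |(e : Config N → ℝ) (cellProj L Y)|) X)
    (X : Config N) : 0 < Ψ₀ X := by
  have hμ₀ : 0 < ‖pfkL2 (N := N) v L 1‖ :=
    norm_pos_iff.2 (pfkL2_perronFrobenius (N := N) hv hL hC one_pos).1
  rw [hΨ]
  exact mul_pos (inv_pos.2 hμ₀) (pfkReal_pos_of_nonneg hv hL hC one_pos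
    (measurable_abs_coeFn_cellProj e) (fun Y => abs_nonneg _) (abs_coeFn_cellProj_periodic hL.ne' e)
    (setLIntegral_cellN_abs_coeFn_cellProj_sq_ne_top hL e) (abs_coeFn_cellProj_not_ae_zero hL he1 he0) X)

end Witness

/-! ### The Rayleigh bound on periodic `L²(cell)` observables -/

/-- **`⟨f, e^{-tH} f⟩_cell ≤ ‖e^{-H}‖ᵗ ‖f‖²_cell`** for every periodic measurable real `f` that is
square integrable on the cell (`t > 0`, `L > 0`, `v^per` bounded): the abstract Rayleigh bound
`inner_semigroup_le_rpow_mul` for the symmetric contraction semigroup `pfkL2 v L ·` and the class of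
`f` in `L²(cell)`. Chung–Zhao (1995), Thm 3.27 (`‖T_t‖₂ = e^{λ₁t}`). [cite: ChungZhao1995, Thm 3.27] -/
theorem setIntegral_cellN_mul_pfkReal_le_rpow {v : ℝ → ℝ≥0∞} (hv : Measurable v) {L : ℝ}
    (hL : 0 < L) {C : ℝ≥0} (hC : ∀ x, periodizedPotential v L x ≤ C) {f : Config N → ℝ}
    (hf : Measurable f)
    (hper : ∀ (X : Config N) (i : Fin N) (k : Fin 3),
      f (X + Pi.single i (EuclideanSpace.single k L)) = f X)
    (hf2 : ∫⁻ Y in cellN N L, ‖f Y‖ₑ ^ (2 : ℝ) ≠ ⊤) {t : ℝ} (ht : 0 < t) :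
    ∫ X in cellN N L, f X * pfkReal v L t f X ≤
      ‖pfkL2 (N := N) v L 1‖ ^ t * ∫ X in cellN N L, f X ^ 2 := by
  have hfm : MemLp f 2 (volume.restrict (cellN N L)) := by
    refine ⟨hf.aestronglyMeasurable, ?_⟩
    rw [eLpNorm_two_eq_cellN]
    exact ENNReal.rpow_lt_top_of_nonneg (by norm_num) hf2
  obtain ⟨F, hF⟩ : ∃ F : Lp ℝ 2 (volume.restrict (cellN N L)), F = hfm.toLp f := ⟨_, rfl⟩
  have hFf : (F : Config N → ℝ) =ᵐ[volume.restrict (cellN N L)] f := by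
    rw [hF]; exact hfm.coeFn_toLp
  have hadd : ∀ s t : ℝ, 0 < s → 0 < t →
      pfkL2 (N := N) v L (s + t) = (pfkL2 v L s).comp (pfkL2 v L t) :=
    fun s t hs ht => pfkL2_add_time hv hL hs ht
  have hcontr : ∀ t : ℝ, 0 < t → ‖pfkL2 (N := N) v L t‖ ≤ 1 := fun t _ => norm_pfkL2_le_one v L t
  have hsym : ∀ t : ℝ, 0 < t → ∀ x y : Lp ℝ 2 (volume.restrict (cellN N L)),
      ⟪pfkL2 v L t x, y⟫_ℝ = ⟪x, pfkL2 v L t y⟫_ℝ := fun t ht x y => inner_pfkL2_comm hv hL ht x y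
  have hμ₀ : 0 < ‖pfkL2 (N := N) v L 1‖ :=
    norm_pos_iff.2 (pfkL2_perronFrobenius (N := N) hv hL hC one_pos).1
  have h1 := inner_semigroup_le_rpow_mul (S := fun t => pfkL2 (N := N) v L t) hadd hcontr hsym hμ₀
    F ht
  have h2 : ∫ X in cellN N L, f X * pfkReal v L t f X = ⟪F, pfkL2 v L t F⟫_ℝ := by
    rw [inner_Lp_eq_integral]
    have h3 : ((pfkL2 v L t F : Lp ℝ 2 (volume.restrict (cellN N L))) : Config N → ℝ)
        =ᵐ[volume.restrict (cellN N L)] pfkReal v L t (⇑F ∘ cellProj L) := pfkL2_coeFn hv hL ht F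
    have h4 : ∀ X, pfkReal v L t (⇑F ∘ cellProj L) X = pfkReal v L t f X := fun X => by
      rw [pfkReal_comp_cellProj_congr_ae v hL ht hFf X, comp_cellProj_eq_self hper]
    refine integral_congr_ae ?_
    filter_upwards [hFf, h3] with X hX h3X
    rw [hX, h3X, h4]
  have h3 : ∫ X in cellN N L, f X ^ 2 = ‖F‖ ^ 2 := by
    rw [← real_inner_self_eq_norm_sq, inner_Lp_eq_integral]
    refine integral_congr_ae ?_
    filter_upwards [hFf] with X hX
    rw [hX, sq]
  rw [h2, h3]
  exact h1

end Literature.MathematicalPhysics.QuantumManyBody.BoseGas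

end
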